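import Literature.MathematicalPhysics.QuantumFieldTheory.Balaban1983to89.Beta.ExpKernelCalculus
import Literature.MathematicalPhysics.QuantumFieldTheory.Balaban1983to89.Beta.PolarizationSign

/-!
# Bałaban's renormalization group, β-function cell (an2, background-field route) — THE WARD IDENTITY (FIRST-BOND TRANSVERSALITY)
OF THE RESOLVENT HESSIAN FROM THE GAUGE COVARIANCE OF ITS INGREDIENTS (the structural half of the `hW` slot of the END corollaries),
with the Fubini bricks it needs: associativity of kernel composition and cyclicity of the trace under product majorants

HONEST FRAMING (page 1, verbatim programme rule). Discharging `FlowStep.BetaPertH` would make Bałaban's ultraviolet stability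
UNCONDITIONAL — a real constructive-QFT result; it is NOT the continuum limit and NOT the Clay problem. This file discharges NOTHING of
`BetaPertH`: it is kernel-checked [folklore] bookkeeping about the abstract resolvent Hessian
`ExpKernelCalculus.hess A V W μ y ν y′ = ½·tadpole A (W μ y ν y′) − ½·bubble A (V μ y) (V ν y′)` and its difference-variable kernel
`hessKer`, of which the typed one-step kernels `OneStepResolventKernel.TOf` and the step-`j` kernels of the background-field route are
instances. No statement of the manuscripts under audit is used; the `[cite]` tag below is a LOCATOR of the printed law whose typed form
is discussed, never a hypothesis.

WHAT IS PROVED ([folklore], sorry-free). Sites are `Fin D → ℤ`, kernels `ExpKernelCalculus.MKer D F` with a finite fibre type `F`.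
* §1 BOUNDED KERNELS (`Bdd`) and CLOSURE OF BI-LOCALISATION (`BiLoc`) under recentring (`biLoc_recentre`, factor
  `e^{δ(|p−p′|₁+|q−q′|₁)}`), sums, differences and finite sums.
* §2 SLICE SUMMABILITY of the middle leg of a composition `K ∘ L` when one factor is bounded and the other bi-localised.
* §3 ADDITIVITY of `comp` (both slots) and `tr` over differences and finite sums, given slice summability (the `tsum`s are genuine
  series, so additivity is conditional; the hypotheses are exactly what `Summable.tsum_sub` / `Summable.tsum_finsetSum` need).
* §4 **FUBINI BRICKS.** `ProdBound G` := a product majorant `|G y z| ≤ φ y · ψ z` with summable nonnegative `φ`, `ψ`; it gives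
  summability on the product and Fubini (`tsum_comm_of_prodBound`, via `Summable.tsum_comm'`). Consequences:
  **associativity** `A ∘ (K ∘ L) = (A ∘ K) ∘ L` under a termwise product majorant of the triple products (`comp_assoc_of_bound`), with
  the two instances used below — decaying ∘ bi-localised ∘ bi-localised (`comp_assoc_dbb`) and bi-localised ∘ decaying ∘ bi-localised
  (`comp_assoc_bdb`); **cyclicity of the trace** `tr (K ∘ L) = tr (L ∘ K)` under a product majorant (`tr_comp_comm_of_bound`), instance:
  two bi-localised kernels (`tr_comp_comm_bb`). (Composition of these kernels is NOT associative and the trace NOT cyclic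
  unconditionally — the `tsum`s take junk values on non-summable families — hence the explicit majorants.)
* §5 LINEARITY of `bubble A · W` in its first vertex slot and of `tadpole A ·` over finite sums of differences of vertex kernels
  bi-localised at common points (`bubble_sum_sub_left`, `tadpole_sum_sub`).
* §6 **THE WARD IDENTITY** (`ward_hess`). Put `divV V y := Σ_μ (V μ (y − e_μ) − V μ y)` (the PURE-GAUGE first-order vertex at the
  coarse site `y`: the response to the background variation `δB_μ(u) = [u = y − e_μ] − [u = y]`, i.e. `B ↦ B + dλ`, `λ = δ_y`) and
  `divW W y ν y′ := Σ_μ (W μ (y − e_μ) ν y′ − W μ y ν y′)`. HYPOTHESES: `A` decays; `V`, `W` are vertex families localised at the coarse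
  bonds (`VertexFamily`, `VertexFamily₂`, scale `N`); a family `X y` of kernels bi-localised at `N • y` (the GENERATOR of the background
  gauge transformation at `y`, acting on the fine legs); and the two JET-LEVEL COVARIANCE LAWS
  (W1) `(A ∘ divV y) ∘ A = A ∘ X y − X y ∘ A`, (W2) `divW y ν y′ = X y ∘ V ν y′ − V ν y′ ∘ X y`.
  (These are the first-order consequences at `λ = δ_y` of a covariance law `Δ(B + t·dλ) = e^{tX_λ} Δ(B) e^{−tX_λ}` for an operator `Δ(B)`
  with inverse `A` and `B`-jets `V`, `W`: differentiating gives `divV = [X, Δ]`, whence `A·divV·A = [A, X]`, and `divW = [X, V′]`.)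
  CONCLUSION: `Σ_μ (hess A V W μ (y − e_μ) ν y′ − hess A V W μ y ν y′) = 0` — the Hessian is transversal in its first bond. The proof
  is the one-line computation `½·tr(A[X,V′]) − ½·tr([A,X]V′) = 0` made honest: every rebracketing is an instance of §4 and every
  splitting of a trace an instance of §3, each under the absolute convergence supplied by the decay classes.
* `wardTransversal_flip_hessKer`: with, in addition, block-translation covariance (`BlockCovariant`, so `hess μ y ν y′ = hessKer μ ν
  (y′ − y)`), the conclusion is the typed printed predicate `PolarizationSign.WardTransversal` — backward first-index divergence law,
  printed difference variable `z = x − y` (first index at `x`) — of the FLIPPED kernel `z ↦ hessKer μ ν (−z)` (`hessKer`'s variable is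
  second-bond-minus-first; same orientation remark as in `Beta.KernelReflection` §5 and `OneStepKernelFamily.wardTransversal_flipK_iff`).

WHAT IS NOT PROVED HERE. (W1)/(W2) — equivalently the background-gauge covariance of the block-averaging operators and of the axial
gauge fixing that produce Bałaban's one-step quadratic form — are NOT verified for any concrete system; `X` is abstract. That
verification (for the typed KKT resolvent `OneStepResolventKernel.KInv` and the stencil jets) is the remaining analytic content of the
`hW` slot. Transversality in the SECOND bond is not derived (it would follow from the same argument at the second bond, or from index
symmetry; neither is done here).

DEPENDENCES. `Beta.ExpKernelCalculus` (kernels, `comp`/`tr`/`bubble`/`tadpole`, `hess`/`hessKer`, `BlockCovariant`, the decay classes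
`Decays`/`BiLoc`/`VertexFamily`/`VertexFamily₂` and their summability lemmas), `Beta.PolarizationSign` (`WardTransversal`),
`B6BondElimination` (`unitVec`).

References (locator for orientation only; no printed statement is used as a hypothesis):
* [B12] T. Bałaban, Renormalization group approach to lattice gauge field theories. I, Comm. Math. Phys. 109 (1987) 249–301,
  the Ward-identity discussion (5.9)–(5.15), p. 293. [cite: Balaban1987RG1]
-/

open Finset
open scoped BigOperators
open Literature.MathematicalPhysics.QuantumFieldTheory.Balaban1983to89
open Literature.MathematicalPhysics.QuantumFieldTheory.Balaban1983to89.Beta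
open B12Sec2to5 (l1 l1_nonneg)
open B6BondElimination (unitVec unitVec_apply)
open PolarizationSign (WardTransversal)
open ExpKernelCalculus (Decays BiLoc comp tr bubble tadpole VertexFamily VertexFamily₂ hess hessKer BlockCovariant Zl
  hess_eq_hessKer summable_exp_shift summable_exp_shift' tsum_exp_shift' biLoc_comp_decays biLoc_comp_biLoc summable_trTerm
  l1_sub_triangle)

namespace Literature.MathematicalPhysics.QuantumFieldTheory.Balaban1983to89.Beta.KernelWard

noncomputable section

variable {D : ℕ} {F : Type*} [Fintype F]

/-! ## §1 Bounded kernels; closure of bi-localisation under recentring, sums and differences -/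

omit [Fintype F] in
/-- UNIFORMLY BOUNDED kernel: `|K x y a b| ≤ B`. [folklore] -/
def Bdd (K : ExpKernelCalculus.MKer D F) (B : ℝ) : Prop := ∀ x y a b, |K x y a b| ≤ B

omit [Fintype F] in
/-- A decaying kernel (rate `δ ≥ 0`) is bounded by its constant. [folklore] -/
theorem bdd_of_decays {A : ExpKernelCalculus.MKer D F} {C δ : ℝ} (h : Decays A C δ) (hδ : 0 ≤ δ) : Bdd A C := by
  intro x y a b
  have h1 := h x y a b
  have hC : 0 ≤ C := nonneg_of_mul_nonneg_left ((abs_nonneg _).trans h1) (Real.exp_pos _)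
  refine h1.trans ?_
  have : Real.exp (-δ * l1 (x - y)) ≤ 1 := Real.exp_le_one_iff.mpr (by nlinarith [l1_nonneg (x - y)])
  calc C * Real.exp (-δ * l1 (x - y)) ≤ C * 1 := mul_le_mul_of_nonneg_left this hC
    _ = C := mul_one _

omit [Fintype F] in
/-- A bi-localised kernel (rate `δ ≥ 0`) is bounded by its constant. [folklore] -/
theorem bdd_of_biLoc {K : ExpKernelCalculus.MKer D F} {p q : Fin D → ℤ} {C δ : ℝ} (h : BiLoc K p q C δ) (hδ : 0 ≤ δ) :
    Bdd K C := by
  intro x y a b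
  have h1 := h x y a b
  have hC : 0 ≤ C := nonneg_of_mul_nonneg_left ((abs_nonneg _).trans h1) (Real.exp_pos _)
  refine h1.trans ?_
  have : Real.exp (-δ * (l1 (x - p) + l1 (y - q))) ≤ 1 :=
    Real.exp_le_one_iff.mpr (by nlinarith [l1_nonneg (x - p), l1_nonneg (y - q)])
  calc C * Real.exp (-δ * (l1 (x - p) + l1 (y - q))) ≤ C * 1 := mul_le_mul_of_nonneg_left this hC
    _ = C := mul_one _

omit [Fintype F] in
/-- RECENTRING a bi-localisation to other points costs the factor `e^{δ(|p−p′|₁ + |q−q′|₁)}`. [folklore] -/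
theorem biLoc_recentre {K : ExpKernelCalculus.MKer D F} {p q : Fin D → ℤ} {C δ : ℝ} (h : BiLoc K p q C δ) (hδ : 0 ≤ δ)
    (p' q' : Fin D → ℤ) : BiLoc K p' q' (C * Real.exp (δ * (l1 (p - p') + l1 (q - q')))) δ := by
  intro x y a b
  have h1 := h x y a b
  have hC : 0 ≤ C := nonneg_of_mul_nonneg_left ((abs_nonneg _).trans h1) (Real.exp_pos _)
  refine h1.trans ?_
  rw [mul_assoc, ← Real.exp_add]
  refine mul_le_mul_of_nonneg_left (Real.exp_le_exp.mpr ?_) hC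
  have e1 := l1_sub_triangle x p p'
  have e2 := l1_sub_triangle y q q'
  nlinarith

omit [Fintype F] in
/-- Sum of two kernels bi-localised at the same points. [folklore] -/
theorem biLoc_add {K L : ExpKernelCalculus.MKer D F} {p q : Fin D → ℤ} {C₁ C₂ δ : ℝ} (h₁ : BiLoc K p q C₁ δ)
    (h₂ : BiLoc L p q C₂ δ) : BiLoc (K + L) p q (C₁ + C₂) δ := by
  intro x y a b
  simp only [Pi.add_apply]
  calc |K x y a b + L x y a b| ≤ |K x y a b| + |L x y a b| := abs_add_le _ _
    _ ≤ _ := by rw [add_mul]; exact add_le_add (h₁ x y a b) (h₂ x y a b)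

omit [Fintype F] in
/-- Difference of two kernels bi-localised at the same points. [folklore] -/
theorem biLoc_sub {K L : ExpKernelCalculus.MKer D F} {p q : Fin D → ℤ} {C₁ C₂ δ : ℝ} (h₁ : BiLoc K p q C₁ δ)
    (h₂ : BiLoc L p q C₂ δ) : BiLoc (K - L) p q (C₁ + C₂) δ := by
  intro x y a b
  simp only [Pi.sub_apply]
  calc |K x y a b - L x y a b| ≤ |K x y a b| + |L x y a b| := abs_sub _ _
    _ ≤ _ := by rw [add_mul]; exact add_le_add (h₁ x y a b) (h₂ x y a b)

omit [Fintype F] in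
/-- Finite sum of kernels bi-localised at the same points. [folklore] -/
theorem biLoc_finset_sum {ι : Type*} (s : Finset ι) {K : ι → ExpKernelCalculus.MKer D F} {p q : Fin D → ℤ} {C : ι → ℝ} {δ : ℝ}
    (h : ∀ i ∈ s, BiLoc (K i) p q (C i) δ) : BiLoc (∑ i ∈ s, K i) p q (∑ i ∈ s, C i) δ := by
  classical
  induction s using Finset.induction_on with
  | empty =>
      intro x y a b
      simp
  | insert i s hi ih =>
      rw [Finset.sum_insert hi, Finset.sum_insert hi]
      exact biLoc_add (h i (Finset.mem_insert_self i s)) (ih fun j hj => h j (Finset.mem_insert_of_mem hj))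

/-! ## §2 Slice summability -/

omit [Fintype F] in
/-- One middle-leg slice, bounded ∘ bi-localised. [folklore] -/
theorem summable_slice_bdd_biLoc {K L : ExpKernelCalculus.MKer D F} {B C δ : ℝ} {p q : Fin D → ℤ} (hK : Bdd K B)
    (hL : BiLoc L p q C δ) (hδ : 0 < δ) (x z : Fin D → ℤ) (a f b : F) :
    Summable fun y : Fin D → ℤ => K x y a f * L y z f b := by
  refine Summable.of_norm_bounded ((summable_exp_shift' hδ p).mul_left (B * C)) (fun y => ?_)
  rw [Real.norm_eq_abs, abs_mul]
  have h1 := hK x y a f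
  have h2 := hL y z f b
  have hC : 0 ≤ C := nonneg_of_mul_nonneg_left ((abs_nonneg _).trans h2) (Real.exp_pos _)
  have h2' : |L y z f b| ≤ C * Real.exp (-δ * l1 (y - p)) := by
    refine h2.trans (mul_le_mul_of_nonneg_left (Real.exp_le_exp.mpr ?_) hC)
    nlinarith [l1_nonneg (z - q), hδ.le]
  calc |K x y a f| * |L y z f b| ≤ B * (C * Real.exp (-δ * l1 (y - p))) :=
        mul_le_mul h1 h2' (abs_nonneg _) ((abs_nonneg _).trans h1)
    _ = B * C * Real.exp (-δ * l1 (y - p)) := by ring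

omit [Fintype F] in
/-- One middle-leg slice, bi-localised ∘ bounded. [folklore] -/
theorem summable_slice_biLoc_bdd {K L : ExpKernelCalculus.MKer D F} {B C δ : ℝ} {p q : Fin D → ℤ} (hK : BiLoc K p q C δ)
    (hL : Bdd L B) (hδ : 0 < δ) (x z : Fin D → ℤ) (a f b : F) :
    Summable fun y : Fin D → ℤ => K x y a f * L y z f b := by
  refine Summable.of_norm_bounded ((summable_exp_shift' hδ q).mul_left (C * B)) (fun y => ?_)
  rw [Real.norm_eq_abs, abs_mul]
  have h1 := hK x y a f
  have h2 := hL y z f b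
  have hC : 0 ≤ C := nonneg_of_mul_nonneg_left ((abs_nonneg _).trans h1) (Real.exp_pos _)
  have h1' : |K x y a f| ≤ C * Real.exp (-δ * l1 (y - q)) := by
    refine h1.trans (mul_le_mul_of_nonneg_left (Real.exp_le_exp.mpr ?_) hC)
    nlinarith [l1_nonneg (x - p), hδ.le]
  calc |K x y a f| * |L y z f b| ≤ (C * Real.exp (-δ * l1 (y - q))) * B :=
        mul_le_mul h1' h2 (abs_nonneg _) ((abs_nonneg _).trans h1')
    _ = C * B * Real.exp (-δ * l1 (y - q)) := by ring

/-- Fibre-summed slices, bounded ∘ bi-localised. [folklore] -/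
theorem slices_bdd_biLoc {K L : ExpKernelCalculus.MKer D F} {B C δ : ℝ} {p q : Fin D → ℤ} (hK : Bdd K B)
    (hL : BiLoc L p q C δ) (hδ : 0 < δ) (x z : Fin D → ℤ) (a b : F) :
    Summable fun y : Fin D → ℤ => ∑ f, K x y a f * L y z f b :=
  summable_sum fun f _ => summable_slice_bdd_biLoc hK hL hδ x z a f b

/-- Fibre-summed slices, bi-localised ∘ bounded. [folklore] -/
theorem slices_biLoc_bdd {K L : ExpKernelCalculus.MKer D F} {B C δ : ℝ} {p q : Fin D → ℤ} (hK : BiLoc K p q C δ)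
    (hL : Bdd L B) (hδ : 0 < δ) (x z : Fin D → ℤ) (a b : F) :
    Summable fun y : Fin D → ℤ => ∑ f, K x y a f * L y z f b :=
  summable_sum fun f _ => summable_slice_biLoc_bdd hK hL hδ x z a f b

/-! ## §3 Additivity of composition and trace (given summability) -/

/-- `A ∘ (K − L) = A ∘ K − A ∘ L`. [folklore] -/
theorem comp_sub_right {A K L : ExpKernelCalculus.MKer D F} (hK : ∀ x z a b, Summable fun y : Fin D → ℤ => ∑ f, A x y a f * K y z f b)
    (hL : ∀ x z a b, Summable fun y : Fin D → ℤ => ∑ f, A x y a f * L y z f b) : comp A (K - L) = comp A K - comp A L := by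
  funext x z a b
  show (∑' y, ∑ f, A x y a f * (K - L) y z f b) = (∑' y, ∑ f, A x y a f * K y z f b) - ∑' y, ∑ f, A x y a f * L y z f b
  rw [← (hK x z a b).tsum_sub (hL x z a b)]
  refine tsum_congr fun y => ?_
  rw [← Finset.sum_sub_distrib]
  refine Finset.sum_congr rfl fun f _ => ?_
  simp only [Pi.sub_apply]
  ring

/-- `(K − L) ∘ M = K ∘ M − L ∘ M`. [folklore] -/
theorem comp_sub_left {K L M : ExpKernelCalculus.MKer D F} (hK : ∀ x z a b, Summable fun y : Fin D → ℤ => ∑ f, K x y a f * M y z f b)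
    (hL : ∀ x z a b, Summable fun y : Fin D → ℤ => ∑ f, L x y a f * M y z f b) : comp (K - L) M = comp K M - comp L M := by
  funext x z a b
  show (∑' y, ∑ f, (K - L) x y a f * M y z f b) = (∑' y, ∑ f, K x y a f * M y z f b) - ∑' y, ∑ f, L x y a f * M y z f b
  rw [← (hK x z a b).tsum_sub (hL x z a b)]
  refine tsum_congr fun y => ?_
  rw [← Finset.sum_sub_distrib]
  refine Finset.sum_congr rfl fun f _ => ?_
  simp only [Pi.sub_apply]
  ring

/-- `tr (K − L) = tr K − tr L`. [folklore] -/
theorem tr_sub {K L : ExpKernelCalculus.MKer D F} (hK : Summable fun x : Fin D → ℤ => ∑ a, K x x a a)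
    (hL : Summable fun x : Fin D → ℤ => ∑ a, L x x a a) : tr (K - L) = tr K - tr L := by
  show (∑' x, ∑ a, (K - L) x x a a) = (∑' x, ∑ a, K x x a a) - ∑' x, ∑ a, L x x a a
  rw [← hK.tsum_sub hL]
  refine tsum_congr fun x => ?_
  rw [← Finset.sum_sub_distrib]
  refine Finset.sum_congr rfl fun a _ => ?_
  simp only [Pi.sub_apply]

/-- `A ∘ (Σ_i K_i) = Σ_i A ∘ K_i`. [folklore] -/
theorem comp_finset_sum_right {ι : Type*} (s : Finset ι) {A : ExpKernelCalculus.MKer D F} {K : ι → ExpKernelCalculus.MKer D F}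
    (hK : ∀ i ∈ s, ∀ x z a b, Summable fun y : Fin D → ℤ => ∑ f, A x y a f * K i y z f b) :
    comp A (∑ i ∈ s, K i) = ∑ i ∈ s, comp A (K i) := by
  funext x z a b
  simp only [Finset.sum_apply]
  show (∑' y, ∑ f, A x y a f * (∑ i ∈ s, K i) y z f b) = ∑ i ∈ s, ∑' y, ∑ f, A x y a f * K i y z f b
  simp only [Finset.sum_apply]
  rw [(Summable.tsum_finsetSum (fun i hi => hK i hi x z a b)).symm]
  refine tsum_congr fun y => ?_
  rw [Finset.sum_comm]
  refine Finset.sum_congr rfl fun f _ => ?_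
  rw [Finset.mul_sum]

/-- `(Σ_i K_i) ∘ M = Σ_i K_i ∘ M`. [folklore] -/
theorem comp_finset_sum_left {ι : Type*} (s : Finset ι) {M : ExpKernelCalculus.MKer D F} {K : ι → ExpKernelCalculus.MKer D F}
    (hK : ∀ i ∈ s, ∀ x z a b, Summable fun y : Fin D → ℤ => ∑ f, K i x y a f * M y z f b) :
    comp (∑ i ∈ s, K i) M = ∑ i ∈ s, comp (K i) M := by
  funext x z a b
  simp only [Finset.sum_apply]
  show (∑' y, ∑ f, (∑ i ∈ s, K i) x y a f * M y z f b) = ∑ i ∈ s, ∑' y, ∑ f, K i x y a f * M y z f b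
  simp only [Finset.sum_apply]
  rw [(Summable.tsum_finsetSum (fun i hi => hK i hi x z a b)).symm]
  refine tsum_congr fun y => ?_
  rw [Finset.sum_comm]
  refine Finset.sum_congr rfl fun f _ => ?_
  rw [Finset.sum_mul]

/-- `tr (Σ_i M_i) = Σ_i tr M_i`. [folklore] -/
theorem tr_finset_sum {ι : Type*} (s : Finset ι) {M : ι → ExpKernelCalculus.MKer D F}
    (hM : ∀ i ∈ s, Summable fun x : Fin D → ℤ => ∑ a, M i x x a a) : tr (∑ i ∈ s, M i) = ∑ i ∈ s, tr (M i) := by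
  show (∑' x, ∑ a, (∑ i ∈ s, M i) x x a a) = ∑ i ∈ s, ∑' x, ∑ a, M i x x a a
  simp only [Finset.sum_apply]
  rw [(Summable.tsum_finsetSum (fun i hi => hM i hi)).symm]
  refine tsum_congr fun x => ?_
  rw [Finset.sum_comm]

/-! ## §4 Fubini bricks: associativity of composition and cyclicity of the trace under a product majorant -/

/-- A PRODUCT MAJORANT for a function of two lattice sites: `|G y z| ≤ φ y · ψ z` with summable nonnegative `φ`, `ψ`. [folklore] -/
def ProdBound (G : (Fin D → ℤ) → (Fin D → ℤ) → ℝ) : Prop :=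
  ∃ φ ψ : (Fin D → ℤ) → ℝ, Summable φ ∧ Summable ψ ∧ (∀ y, 0 ≤ φ y) ∧ (∀ z, 0 ≤ ψ z) ∧ ∀ y z, |G y z| ≤ φ y * ψ z

/-- A product majorant gives summability on the product and of all slices. [folklore] -/
theorem ProdBound.summable {G : (Fin D → ℤ) → (Fin D → ℤ) → ℝ} (h : ProdBound G) :
    Summable (Function.uncurry G) ∧ (∀ y, Summable (G y)) ∧ (∀ z, Summable fun y => G y z) := by
  obtain ⟨φ, ψ, hφ, hψ, hφ0, hψ0, hle⟩ := h
  refine ⟨?_, fun y => ?_, fun z => ?_⟩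
  · refine Summable.of_norm_bounded (hφ.mul_of_nonneg hψ (fun y => hφ0 y) (fun z => hψ0 z)) (fun p => ?_)
    rw [Real.norm_eq_abs]
    exact hle p.1 p.2
  · refine Summable.of_norm_bounded (hψ.mul_left (φ y)) (fun z => ?_)
    rw [Real.norm_eq_abs]
    exact hle y z
  · refine Summable.of_norm_bounded (hφ.mul_right (ψ z)) (fun y => ?_)
    rw [Real.norm_eq_abs]
    exact hle y z

/-- FUBINI for a product-majorised double series. [folklore] -/
theorem tsum_comm_of_prodBound {G : (Fin D → ℤ) → (Fin D → ℤ) → ℝ} (h : ProdBound G) :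
    ∑' y, ∑' z, G y z = ∑' z, ∑' y, G y z := by
  obtain ⟨h0, h1, h2⟩ := h.summable
  exact (h0.tsum_comm' h1 h2).symm

/-- **ASSOCIATIVITY OF COMPOSITION** under a termwise product majorant for the triple products. [folklore] -/
theorem comp_assoc_of_bound {A K L : ExpKernelCalculus.MKer D F}
    (h : ∀ x w a b, ∃ φ ψ : (Fin D → ℤ) → ℝ, Summable φ ∧ Summable ψ ∧ (∀ y, 0 ≤ φ y) ∧ (∀ z, 0 ≤ ψ z) ∧
      ∀ y z f g, |A x y a f * K y z f g * L z w g b| ≤ φ y * ψ z) :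
    comp A (comp K L) = comp (comp A K) L := by
  classical
  funext x w a b
  obtain ⟨φ, ψ, hφ, hψ, hφ0, hψ0, hle⟩ := h x w a b
  have hGb : ProdBound (fun y z => ∑ f, ∑ g, A x y a f * K y z f g * L z w g b) := by
    refine ⟨fun y => (Fintype.card F : ℝ) * ((Fintype.card F : ℝ) * φ y), ψ, (hφ.mul_left _).mul_left _, hψ,
      fun y => mul_nonneg (Nat.cast_nonneg _) (mul_nonneg (Nat.cast_nonneg _) (hφ0 y)), hψ0, fun y z => ?_⟩
    calc |∑ f, ∑ g, A x y a f * K y z f g * L z w g b| ≤ ∑ f, |∑ g, A x y a f * K y z f g * L z w g b| :=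
          Finset.abs_sum_le_sum_abs _ _
      _ ≤ ∑ f, ∑ g, |A x y a f * K y z f g * L z w g b| := Finset.sum_le_sum fun f _ => Finset.abs_sum_le_sum_abs _ _
      _ ≤ ∑ _f : F, ∑ _g : F, φ y * ψ z := Finset.sum_le_sum fun f _ => Finset.sum_le_sum fun g _ => hle y z f g
      _ = (Fintype.card F : ℝ) * ((Fintype.card F : ℝ) * φ y) * ψ z := by
          simp only [Finset.sum_const, Finset.card_univ, nsmul_eq_mul]; ring
  have hz : ∀ y f, Summable fun z : Fin D → ℤ => A x y a f * ∑ g, K y z f g * L z w g b := by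
    intro y f
    refine Summable.of_norm_bounded (hψ.mul_left ((Fintype.card F : ℝ) * φ y)) (fun z => ?_)
    rw [Real.norm_eq_abs, Finset.mul_sum]
    calc |∑ g, A x y a f * (K y z f g * L z w g b)| ≤ ∑ g, |A x y a f * (K y z f g * L z w g b)| :=
          Finset.abs_sum_le_sum_abs _ _
      _ ≤ ∑ _g : F, φ y * ψ z := Finset.sum_le_sum fun g _ => by rw [← mul_assoc]; exact hle y z f g
      _ = (Fintype.card F : ℝ) * φ y * ψ z := by simp only [Finset.sum_const, Finset.card_univ, nsmul_eq_mul]; ring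
  have hy : ∀ z g, Summable fun y : Fin D → ℤ => (∑ f, A x y a f * K y z f g) * L z w g b := by
    intro z g
    refine Summable.of_norm_bounded ((hφ.mul_left (Fintype.card F : ℝ)).mul_right (ψ z)) (fun y => ?_)
    rw [Real.norm_eq_abs, Finset.sum_mul]
    calc |∑ f, A x y a f * K y z f g * L z w g b| ≤ ∑ f, |A x y a f * K y z f g * L z w g b| :=
          Finset.abs_sum_le_sum_abs _ _
      _ ≤ ∑ _f : F, φ y * ψ z := Finset.sum_le_sum fun f _ => hle y z f g
      _ = (Fintype.card F : ℝ) * φ y * ψ z := by simp only [Finset.sum_const, Finset.card_univ, nsmul_eq_mul]; ring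
  have lhs : comp A (comp K L) x w a b = ∑' y, ∑' z, ∑ f, ∑ g, A x y a f * K y z f g * L z w g b := by
    show (∑' y, ∑ f, A x y a f * ∑' z, ∑ g, K y z f g * L z w g b) = _
    refine tsum_congr fun y => ?_
    calc (∑ f, A x y a f * ∑' z, ∑ g, K y z f g * L z w g b)
        = ∑ f, ∑' z, A x y a f * ∑ g, K y z f g * L z w g b := by
          refine Finset.sum_congr rfl fun f _ => ?_
          rw [tsum_mul_left]
      _ = ∑' z, ∑ f, A x y a f * ∑ g, K y z f g * L z w g b := (Summable.tsum_finsetSum (fun f _ => hz y f)).symm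
      _ = ∑' z, ∑ f, ∑ g, A x y a f * K y z f g * L z w g b := by
          refine tsum_congr fun z => Finset.sum_congr rfl fun f _ => ?_
          rw [Finset.mul_sum]
          refine Finset.sum_congr rfl fun g _ => ?_
          ring
  have rhs : comp (comp A K) L x w a b = ∑' z, ∑' y, ∑ f, ∑ g, A x y a f * K y z f g * L z w g b := by
    show (∑' z, ∑ g, (∑' y, ∑ f, A x y a f * K y z f g) * L z w g b) = _
    refine tsum_congr fun z => ?_
    calc (∑ g, (∑' y, ∑ f, A x y a f * K y z f g) * L z w g b)
        = ∑ g, ∑' y, (∑ f, A x y a f * K y z f g) * L z w g b := by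
          refine Finset.sum_congr rfl fun g _ => ?_
          rw [tsum_mul_right]
      _ = ∑' y, ∑ g, (∑ f, A x y a f * K y z f g) * L z w g b := (Summable.tsum_finsetSum (fun g _ => hy z g)).symm
      _ = ∑' y, ∑ f, ∑ g, A x y a f * K y z f g * L z w g b := by
          refine tsum_congr fun y => ?_
          calc (∑ g, (∑ f, A x y a f * K y z f g) * L z w g b) = ∑ g, ∑ f, A x y a f * K y z f g * L z w g b := by
                refine Finset.sum_congr rfl fun g _ => ?_
                rw [Finset.sum_mul]
            _ = ∑ f, ∑ g, A x y a f * K y z f g * L z w g b := Finset.sum_comm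
  rw [lhs, rhs]
  exact tsum_comm_of_prodBound hGb

/-- **CYCLICITY OF THE TRACE** under a termwise product majorant: `tr (K ∘ L) = tr (L ∘ K)`. [folklore] -/
theorem tr_comp_comm_of_bound {K L : ExpKernelCalculus.MKer D F}
    (h : ∃ φ ψ : (Fin D → ℤ) → ℝ, Summable φ ∧ Summable ψ ∧ (∀ x, 0 ≤ φ x) ∧ (∀ y, 0 ≤ ψ y) ∧
      ∀ x y a f, |K x y a f * L y x f a| ≤ φ x * ψ y) :
    tr (comp K L) = tr (comp L K) := by
  classical
  obtain ⟨φ, ψ, hφ, hψ, hφ0, hψ0, hle⟩ := h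
  have hGb : ProdBound (fun x y => ∑ a, ∑ f, K x y a f * L y x f a) := by
    refine ⟨fun x => (Fintype.card F : ℝ) * ((Fintype.card F : ℝ) * φ x), ψ, (hφ.mul_left _).mul_left _, hψ,
      fun x => mul_nonneg (Nat.cast_nonneg _) (mul_nonneg (Nat.cast_nonneg _) (hφ0 x)), hψ0, fun x y => ?_⟩
    calc |∑ a, ∑ f, K x y a f * L y x f a| ≤ ∑ a, |∑ f, K x y a f * L y x f a| := Finset.abs_sum_le_sum_abs _ _
      _ ≤ ∑ a, ∑ f, |K x y a f * L y x f a| := Finset.sum_le_sum fun a _ => Finset.abs_sum_le_sum_abs _ _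
      _ ≤ ∑ _a : F, ∑ _f : F, φ x * ψ y := Finset.sum_le_sum fun a _ => Finset.sum_le_sum fun f _ => hle x y a f
      _ = (Fintype.card F : ℝ) * ((Fintype.card F : ℝ) * φ x) * ψ y := by
          simp only [Finset.sum_const, Finset.card_univ, nsmul_eq_mul]; ring
  have hy : ∀ x a, Summable fun y : Fin D → ℤ => ∑ f, K x y a f * L y x f a := by
    intro x a
    refine Summable.of_norm_bounded (hψ.mul_left ((Fintype.card F : ℝ) * φ x)) (fun y => ?_)
    rw [Real.norm_eq_abs]
    calc |∑ f, K x y a f * L y x f a| ≤ ∑ f, |K x y a f * L y x f a| := Finset.abs_sum_le_sum_abs _ _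
      _ ≤ ∑ _f : F, φ x * ψ y := Finset.sum_le_sum fun f _ => hle x y a f
      _ = (Fintype.card F : ℝ) * φ x * ψ y := by simp only [Finset.sum_const, Finset.card_univ, nsmul_eq_mul]; ring
  have hx : ∀ y f, Summable fun x : Fin D → ℤ => ∑ a, L y x f a * K x y a f := by
    intro y f
    refine Summable.of_norm_bounded ((hφ.mul_left (Fintype.card F : ℝ)).mul_right (ψ y)) (fun x => ?_)
    rw [Real.norm_eq_abs]
    calc |∑ a, L y x f a * K x y a f| ≤ ∑ a, |L y x f a * K x y a f| := Finset.abs_sum_le_sum_abs _ _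
      _ ≤ ∑ _a : F, φ x * ψ y := Finset.sum_le_sum fun a _ => by rw [mul_comm]; exact hle x y a f
      _ = (Fintype.card F : ℝ) * φ x * ψ y := by simp only [Finset.sum_const, Finset.card_univ, nsmul_eq_mul]; ring
  have lhs : tr (comp K L) = ∑' x, ∑' y, ∑ a, ∑ f, K x y a f * L y x f a := by
    show (∑' x, ∑ a, ∑' y, ∑ f, K x y a f * L y x f a) = _
    exact tsum_congr fun x => (Summable.tsum_finsetSum (fun a _ => hy x a)).symm
  have rhs : tr (comp L K) = ∑' y, ∑' x, ∑ a, ∑ f, K x y a f * L y x f a := by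
    show (∑' y, ∑ f, ∑' x, ∑ a, L y x f a * K x y a f) = _
    refine tsum_congr fun y => ?_
    rw [(Summable.tsum_finsetSum (fun f _ => hx y f)).symm]
    refine tsum_congr fun x => ?_
    rw [Finset.sum_comm]
    refine Finset.sum_congr rfl fun a _ => Finset.sum_congr rfl fun f _ => ?_
    ring
  rw [lhs, rhs]
  exact tsum_comm_of_prodBound hGb

/-- Associativity, decaying ∘ bi-localised ∘ bi-localised. [folklore] -/
theorem comp_assoc_dbb {A K L : ExpKernelCalculus.MKer D F} {C Ck Cl δ : ℝ} {p q p' q' : Fin D → ℤ} (hA : Decays A C δ)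
    (hK : BiLoc K p q Ck δ) (hL : BiLoc L p' q' Cl δ) (hδ : 0 < δ) : comp A (comp K L) = comp (comp A K) L := by
  refine comp_assoc_of_bound fun x w a b => ?_
  have hC : 0 ≤ C := hA.nonneg a
  have hCk : 0 ≤ Ck := hK.nonneg a
  have hCl : 0 ≤ Cl := hL.nonneg a
  refine ⟨fun y => C * Ck * Cl * Real.exp (-δ * l1 (y - p)), fun z => Real.exp (-δ * l1 (z - q)),
    (summable_exp_shift' hδ p).mul_left _, summable_exp_shift' hδ q, fun y => by positivity, fun z => by positivity,
    fun y z f g => ?_⟩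
  have h1 : |A x y a f| ≤ C := bdd_of_decays hA hδ.le x y a f
  have h2 : |K y z f g| ≤ Ck * Real.exp (-δ * l1 (y - p)) * Real.exp (-δ * l1 (z - q)) := by
    have := hK y z f g
    rwa [show -δ * (l1 (y - p) + l1 (z - q)) = -δ * l1 (y - p) + -δ * l1 (z - q) by ring, Real.exp_add, ← mul_assoc] at this
  have h3 : |L z w g b| ≤ Cl := bdd_of_biLoc hL hδ.le z w g b
  rw [abs_mul, abs_mul]
  calc |A x y a f| * |K y z f g| * |L z w g b| ≤ C * (Ck * Real.exp (-δ * l1 (y - p)) * Real.exp (-δ * l1 (z - q))) * Cl :=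
        mul_le_mul (mul_le_mul h1 h2 (abs_nonneg _) hC) h3 (abs_nonneg _) (mul_nonneg hC (by positivity))
    _ = C * Ck * Cl * Real.exp (-δ * l1 (y - p)) * Real.exp (-δ * l1 (z - q)) := by ring

/-- Associativity, bi-localised ∘ decaying ∘ bi-localised. [folklore] -/
theorem comp_assoc_bdb {P A L : ExpKernelCalculus.MKer D F} {C Cp Cl δ : ℝ} {p q p' q' : Fin D → ℤ} (hP : BiLoc P p q Cp δ)
    (hA : Decays A C δ) (hL : BiLoc L p' q' Cl δ) (hδ : 0 < δ) : comp P (comp A L) = comp (comp P A) L := by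
  refine comp_assoc_of_bound fun x w a b => ?_
  have hC : 0 ≤ C := hA.nonneg a
  have hCp : 0 ≤ Cp := hP.nonneg a
  have hCl : 0 ≤ Cl := hL.nonneg a
  refine ⟨fun y => Cp * C * Cl * Real.exp (-δ * l1 (y - q)), fun z => Real.exp (-δ * l1 (z - p')),
    (summable_exp_shift' hδ q).mul_left _, summable_exp_shift' hδ p', fun y => by positivity, fun z => by positivity,
    fun y z f g => ?_⟩
  have h1 : |P x y a f| ≤ Cp * Real.exp (-δ * l1 (y - q)) := by
    refine (hP x y a f).trans (mul_le_mul_of_nonneg_left (Real.exp_le_exp.mpr ?_) hCp)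
    nlinarith [l1_nonneg (x - p), hδ.le]
  have h2 : |A y z f g| ≤ C := bdd_of_decays hA hδ.le y z f g
  have h3 : |L z w g b| ≤ Cl * Real.exp (-δ * l1 (z - p')) := by
    refine (hL z w g b).trans (mul_le_mul_of_nonneg_left (Real.exp_le_exp.mpr ?_) hCl)
    nlinarith [l1_nonneg (w - q'), hδ.le]
  rw [abs_mul, abs_mul]
  calc |P x y a f| * |A y z f g| * |L z w g b| ≤ (Cp * Real.exp (-δ * l1 (y - q))) * C * (Cl * Real.exp (-δ * l1 (z - p'))) :=
        mul_le_mul (mul_le_mul h1 h2 (abs_nonneg _) (by positivity)) h3 (abs_nonneg _) (by positivity)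
    _ = Cp * C * Cl * Real.exp (-δ * l1 (y - q)) * Real.exp (-δ * l1 (z - p')) := by ring

/-- Cyclicity of the trace for two bi-localised kernels. [folklore] -/
theorem tr_comp_comm_bb {K L : ExpKernelCalculus.MKer D F} {Ck Cl δ : ℝ} {p q p' q' : Fin D → ℤ} (hK : BiLoc K p q Ck δ)
    (hL : BiLoc L p' q' Cl δ) (hδ : 0 < δ) : tr (comp K L) = tr (comp L K) := by
  classical
  by_cases hF : Nonempty F
  · obtain ⟨a₀⟩ := hF
    have hCk : 0 ≤ Ck := hK.nonneg a₀
    have hCl : 0 ≤ Cl := hL.nonneg a₀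
    refine tr_comp_comm_of_bound ⟨fun x => Ck * Cl * Real.exp (-δ * l1 (x - p)), fun y => Real.exp (-δ * l1 (y - q)),
      (summable_exp_shift' hδ p).mul_left _, summable_exp_shift' hδ q, fun x => by positivity, fun y => by positivity,
      fun x y a f => ?_⟩
    have h1 : |K x y a f| ≤ Ck * Real.exp (-δ * l1 (x - p)) * Real.exp (-δ * l1 (y - q)) := by
      have := hK x y a f
      rwa [show -δ * (l1 (x - p) + l1 (y - q)) = -δ * l1 (x - p) + -δ * l1 (y - q) by ring, Real.exp_add, ← mul_assoc] at this
    have h2 : |L y x f a| ≤ Cl := bdd_of_biLoc hL hδ.le y x f a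
    rw [abs_mul]
    calc |K x y a f| * |L y x f a| ≤ (Ck * Real.exp (-δ * l1 (x - p)) * Real.exp (-δ * l1 (y - q))) * Cl :=
          mul_le_mul h1 h2 (abs_nonneg _) (by positivity)
      _ = Ck * Cl * Real.exp (-δ * l1 (x - p)) * Real.exp (-δ * l1 (y - q)) := by ring
  · have hE : IsEmpty F := not_nonempty_iff.mp hF
    simp [ExpKernelCalculus.tr]

/-! ## §5 Linearity of bubble and tadpole in the vertex slots over finite sums of differences -/

/-- `bubble A (Σ_i (K₁ i − K₂ i)) W = Σ_i (bubble A (K₁ i) W − bubble A (K₂ i) W)` for vertex kernels bi-localised at a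
common point (recentre first with `biLoc_recentre`). [folklore] -/
theorem bubble_sum_sub_left {ι : Type*} (s : Finset ι) {A W : ExpKernelCalculus.MKer D F} {K₁ K₂ : ι → ExpKernelCalculus.MKer D F}
    {C Cw δ : ℝ} {C₁ C₂ : ι → ℝ} {p q : Fin D → ℤ} (hA : Decays A C δ) (h₁ : ∀ i ∈ s, BiLoc (K₁ i) p p (C₁ i) δ)
    (h₂ : ∀ i ∈ s, BiLoc (K₂ i) p p (C₂ i) δ) (hW : BiLoc W q q Cw δ) (hδ : 0 < δ) :
    bubble A (∑ i ∈ s, (K₁ i - K₂ i)) W = ∑ i ∈ s, (bubble A (K₁ i) W - bubble A (K₂ i) W) := by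
  have hδ2 : 0 < δ / 2 := by linarith
  have hAb : Bdd A C := bdd_of_decays hA hδ.le
  -- the composed kernels and their localisations
  have hY := biLoc_comp_decays hA hW (show 0 ≤ δ / 2 by linarith) (show δ / 2 < δ by linarith)
  have hYb := bdd_of_biLoc hY hδ2.le
  have hX₁ : ∀ i ∈ s, BiLoc (comp A (K₁ i)) p p ((Fintype.card F : ℝ) * (C * C₁ i) * Zl D (δ - δ / 2)) (δ / 2) :=
    fun i hi => biLoc_comp_decays hA (h₁ i hi) (by linarith) (by linarith)
  have hX₂ : ∀ i ∈ s, BiLoc (comp A (K₂ i)) p p ((Fintype.card F : ℝ) * (C * C₂ i) * Zl D (δ - δ / 2)) (δ / 2) :=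
    fun i hi => biLoc_comp_decays hA (h₂ i hi) (by linarith) (by linarith)
  -- step 1: distribute `comp A`
  have hs₁ : ∀ i ∈ s, ∀ x z a b, Summable fun y : Fin D → ℤ => ∑ f, A x y a f * K₁ i y z f b :=
    fun i hi => slices_bdd_biLoc hAb (h₁ i hi) hδ
  have hs₂ : ∀ i ∈ s, ∀ x z a b, Summable fun y : Fin D → ℤ => ∑ f, A x y a f * K₂ i y z f b :=
    fun i hi => slices_bdd_biLoc hAb (h₂ i hi) hδ
  have hS₁ := biLoc_finset_sum s h₁
  have hS₂ := biLoc_finset_sum s h₂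
  have e1 : comp A (∑ i ∈ s, (K₁ i - K₂ i)) = ∑ i ∈ s, comp A (K₁ i) - ∑ i ∈ s, comp A (K₂ i) := by
    rw [Finset.sum_sub_distrib, comp_sub_right (slices_bdd_biLoc hAb hS₁ hδ) (slices_bdd_biLoc hAb hS₂ hδ),
      comp_finset_sum_right s hs₁, comp_finset_sum_right s hs₂]
  -- step 2: distribute the right composition with `Y := comp A W`
  have hT₁ := biLoc_finset_sum s hX₁
  have hT₂ := biLoc_finset_sum s hX₂
  have e2 : comp (∑ i ∈ s, comp A (K₁ i) - ∑ i ∈ s, comp A (K₂ i)) (comp A W)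
      = ∑ i ∈ s, comp (comp A (K₁ i)) (comp A W) - ∑ i ∈ s, comp (comp A (K₂ i)) (comp A W) := by
    rw [comp_sub_left (slices_biLoc_bdd hT₁ hYb hδ2) (slices_biLoc_bdd hT₂ hYb hδ2),
      comp_finset_sum_left s (fun i hi => slices_biLoc_bdd (hX₁ i hi) hYb hδ2),
      comp_finset_sum_left s (fun i hi => slices_biLoc_bdd (hX₂ i hi) hYb hδ2)]
  -- step 3: distribute the trace
  have hM₁ : ∀ i ∈ s, Summable fun x : Fin D → ℤ => ∑ a, comp (comp A (K₁ i)) (comp A W) x x a a :=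
    fun i hi => summable_trTerm (biLoc_comp_biLoc (hX₁ i hi) hY hδ2) hδ2
  have hM₂ : ∀ i ∈ s, Summable fun x : Fin D → ℤ => ∑ a, comp (comp A (K₂ i)) (comp A W) x x a a :=
    fun i hi => summable_trTerm (biLoc_comp_biLoc (hX₂ i hi) hY hδ2) hδ2
  have hN₁ : Summable fun x : Fin D → ℤ => ∑ a, (∑ i ∈ s, comp (comp A (K₁ i)) (comp A W)) x x a a := by
    have : (fun x : Fin D → ℤ => ∑ a, (∑ i ∈ s, comp (comp A (K₁ i)) (comp A W)) x x a a)
        = fun x => ∑ i ∈ s, ∑ a, comp (comp A (K₁ i)) (comp A W) x x a a := by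
      funext x; simp only [Finset.sum_apply]; rw [Finset.sum_comm]
    rw [this]; exact summable_sum fun i hi => hM₁ i hi
  have hN₂ : Summable fun x : Fin D → ℤ => ∑ a, (∑ i ∈ s, comp (comp A (K₂ i)) (comp A W)) x x a a := by
    have : (fun x : Fin D → ℤ => ∑ a, (∑ i ∈ s, comp (comp A (K₂ i)) (comp A W)) x x a a)
        = fun x => ∑ i ∈ s, ∑ a, comp (comp A (K₂ i)) (comp A W) x x a a := by
      funext x; simp only [Finset.sum_apply]; rw [Finset.sum_comm]
    rw [this]; exact summable_sum fun i hi => hM₂ i hi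
  unfold ExpKernelCalculus.bubble
  rw [e1, e2, tr_sub hN₁ hN₂, tr_finset_sum s hM₁, tr_finset_sum s hM₂, ← Finset.sum_sub_distrib]

/-- `tadpole A (Σ_i (W₁ i − W₂ i)) = Σ_i (tadpole A (W₁ i) − tadpole A (W₂ i))`. [folklore] -/
theorem tadpole_sum_sub {ι : Type*} (s : Finset ι) {A : ExpKernelCalculus.MKer D F} {W₁ W₂ : ι → ExpKernelCalculus.MKer D F}
    {C δ : ℝ} {C₁ C₂ : ι → ℝ} {p q : Fin D → ℤ} (hA : Decays A C δ) (h₁ : ∀ i ∈ s, BiLoc (W₁ i) p q (C₁ i) δ)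
    (h₂ : ∀ i ∈ s, BiLoc (W₂ i) p q (C₂ i) δ) (hδ : 0 < δ) :
    tadpole A (∑ i ∈ s, (W₁ i - W₂ i)) = ∑ i ∈ s, (tadpole A (W₁ i) - tadpole A (W₂ i)) := by
  have hδ2 : 0 < δ / 2 := by linarith
  have hAb : Bdd A C := bdd_of_decays hA hδ.le
  have hs₁ : ∀ i ∈ s, ∀ x z a b, Summable fun y : Fin D → ℤ => ∑ f, A x y a f * W₁ i y z f b :=
    fun i hi => slices_bdd_biLoc hAb (h₁ i hi) hδ
  have hs₂ : ∀ i ∈ s, ∀ x z a b, Summable fun y : Fin D → ℤ => ∑ f, A x y a f * W₂ i y z f b :=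
    fun i hi => slices_bdd_biLoc hAb (h₂ i hi) hδ
  have hS₁ := biLoc_finset_sum s h₁
  have hS₂ := biLoc_finset_sum s h₂
  have e1 : comp A (∑ i ∈ s, (W₁ i - W₂ i)) = ∑ i ∈ s, comp A (W₁ i) - ∑ i ∈ s, comp A (W₂ i) := by
    rw [Finset.sum_sub_distrib, comp_sub_right (slices_bdd_biLoc hAb hS₁ hδ) (slices_bdd_biLoc hAb hS₂ hδ),
      comp_finset_sum_right s hs₁, comp_finset_sum_right s hs₂]
  have hM₁ : ∀ i ∈ s, Summable fun x : Fin D → ℤ => ∑ a, comp A (W₁ i) x x a a :=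
    fun i hi => summable_trTerm (biLoc_comp_decays hA (h₁ i hi) (show 0 ≤ δ / 2 by linarith) (show δ / 2 < δ by linarith)) hδ2
  have hM₂ : ∀ i ∈ s, Summable fun x : Fin D → ℤ => ∑ a, comp A (W₂ i) x x a a :=
    fun i hi => summable_trTerm (biLoc_comp_decays hA (h₂ i hi) (show 0 ≤ δ / 2 by linarith) (show δ / 2 < δ by linarith)) hδ2
  have hN₁ : Summable fun x : Fin D → ℤ => ∑ a, (∑ i ∈ s, comp A (W₁ i)) x x a a := by
    have : (fun x : Fin D → ℤ => ∑ a, (∑ i ∈ s, comp A (W₁ i)) x x a a) = fun x => ∑ i ∈ s, ∑ a, comp A (W₁ i) x x a a := by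
      funext x; simp only [Finset.sum_apply]; rw [Finset.sum_comm]
    rw [this]; exact summable_sum fun i hi => hM₁ i hi
  have hN₂ : Summable fun x : Fin D → ℤ => ∑ a, (∑ i ∈ s, comp A (W₂ i)) x x a a := by
    have : (fun x : Fin D → ℤ => ∑ a, (∑ i ∈ s, comp A (W₂ i)) x x a a) = fun x => ∑ i ∈ s, ∑ a, comp A (W₂ i) x x a a := by
      funext x; simp only [Finset.sum_apply]; rw [Finset.sum_comm]
    rw [this]; exact summable_sum fun i hi => hM₂ i hi
  unfold ExpKernelCalculus.tadpole
  rw [e1, tr_sub hN₁ hN₂, tr_finset_sum s hM₁, tr_finset_sum s hM₂, ← Finset.sum_sub_distrib]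

/-! ## §6 The Ward identity of the resolvent Hessian from the gauge covariance of its ingredients -/

/-- THE PURE-GAUGE FIRST-ORDER VERTEX at the coarse site `y`: `Σ_μ (V μ (y − e_μ) − V μ y)` (the first-order response to the
background variation `B ↦ B + dλ`, `λ = δ_y`, i.e. `δB_μ(u) = [u = y − e_μ] − [u = y]`). [folklore] -/
def divV (V : Fin D → (Fin D → ℤ) → ExpKernelCalculus.MKer D F) (y : Fin D → ℤ) : ExpKernelCalculus.MKer D F :=
  ∑ μ, (V μ (y - unitVec μ) - V μ y)

/-- THE PURE-GAUGE SLICE OF THE SECOND-ORDER VERTEX: `Σ_μ (W μ (y − e_μ) ν y′ − W μ y ν y′)`. [folklore] -/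
def divW (W : Fin D → (Fin D → ℤ) → Fin D → (Fin D → ℤ) → ExpKernelCalculus.MKer D F) (y : Fin D → ℤ) (ν : Fin D)
    (y' : Fin D → ℤ) : ExpKernelCalculus.MKer D F :=
  ∑ μ, (W μ (y - unitVec μ) ν y' - W μ y ν y')

/-- **THE WARD IDENTITY OF THE RESOLVENT HESSIAN.** Let `A` decay, the vertex families be localised at the coarse bonds, and let
`X y` (the GENERATOR of the background gauge transformation at the coarse site `y`, acting on the fine legs) be bi-localised at
`N • y`. If
(W1) `(A ∘ divV y) ∘ A = A ∘ X y − X y ∘ A` — the pure-gauge first-order vertex is a commutator with the generator (the jet form of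
`G(B + dλ) = e^{X} G(B) e^{−X}` for the bordered operator `G = A⁻¹`), and
(W2) `divW y ν y′ = X y ∘ V ν y′ − V ν y′ ∘ X y` — the pure-gauge slice of the second jet is the generator's action on the first jet,
then the Hessian is TRANSVERSAL in its first bond: `Σ_μ (hess μ (y − e_μ) ν y′ − hess μ y ν y′) = 0`. The proof is the one-line
trace computation `tr(A[X,V′]) = tr([A,X]V′)` made honest (absolute convergence, Fubini, cyclicity). [folklore] -/
theorem ward_hess {A : ExpKernelCalculus.MKer D F} {V : Fin D → (Fin D → ℤ) → ExpKernelCalculus.MKer D F}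
    {W : Fin D → (Fin D → ℤ) → Fin D → (Fin D → ℤ) → ExpKernelCalculus.MKer D F} {C Cv Cw Cx δ : ℝ} {N : ℕ}
    (X : (Fin D → ℤ) → ExpKernelCalculus.MKer D F)
    (hA : Decays A C δ) (hV : VertexFamily V N Cv δ) (hW : VertexFamily₂ W N Cw δ)
    (hX : ∀ y, BiLoc (X y) ((N : ℤ) • y) ((N : ℤ) • y) Cx δ) (hδ : 0 < δ)
    (hW1 : ∀ y, comp (comp A (divV V y)) A = comp A (X y) - comp (X y) A)
    (hW2 : ∀ y ν y', divW W y ν y' = comp (X y) (V ν y') - comp (V ν y') (X y))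
    (y : Fin D → ℤ) (ν : Fin D) (y' : Fin D → ℤ) :
    ∑ μ, (hess A V W μ (y - unitVec μ) ν y' - hess A V W μ y ν y') = 0 := by
  have hδ2 : 0 < δ / 2 := by linarith
  have hAb : Bdd A C := bdd_of_decays hA hδ.le
  -- localisations at the common points `N•y` (first bond) / `N•y′` (second bond), after recentring
  set P : Fin D → ℤ := (N : ℤ) • y with hPdef
  set Q : Fin D → ℤ := (N : ℤ) • y' with hQdef
  have hV₁ : ∀ μ ∈ (Finset.univ : Finset (Fin D)), BiLoc (V μ (y - unitVec μ)) P P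
      (Cv * Real.exp (δ * (l1 ((N : ℤ) • (y - unitVec μ) - P) + l1 ((N : ℤ) • (y - unitVec μ) - P)))) δ :=
    fun μ _ => biLoc_recentre (hV μ (y - unitVec μ)) hδ.le P P
  have hV₂ : ∀ μ ∈ (Finset.univ : Finset (Fin D)), BiLoc (V μ y) P P (Cv * Real.exp (δ * (l1 (P - P) + l1 (P - P)))) δ :=
    fun μ _ => biLoc_recentre (hV μ y) hδ.le P P
  have hW₁ : ∀ μ ∈ (Finset.univ : Finset (Fin D)), BiLoc (W μ (y - unitVec μ) ν y') P Q
      (Cw * Real.exp (δ * (l1 ((N : ℤ) • (y - unitVec μ) - P) + l1 (Q - Q)))) δ :=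
    fun μ _ => biLoc_recentre (hW μ (y - unitVec μ) ν y') hδ.le P Q
  have hW₂ : ∀ μ ∈ (Finset.univ : Finset (Fin D)), BiLoc (W μ y ν y') P Q (Cw * Real.exp (δ * (l1 (P - P) + l1 (Q - Q)))) δ :=
    fun μ _ => biLoc_recentre (hW μ y ν y') hδ.le P Q
  have hV' : BiLoc (V ν y') Q Q Cv δ := hV ν y'
  have hXy : BiLoc (X y) P P Cx δ := hX y
  -- step 1: the divergence of `hess` is `½ tadpole A (divW) − ½ bubble A (divV) V′`
  have e1 : ∑ μ, (hess A V W μ (y - unitVec μ) ν y' - hess A V W μ y ν y')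
      = (1 / 2) * tadpole A (divW W y ν y') - (1 / 2) * bubble A (divV V y) (V ν y') := by
    unfold divW divV
    rw [tadpole_sum_sub Finset.univ hA hW₁ hW₂ hδ, bubble_sum_sub_left Finset.univ hA hV₁ hV₂ hV' hδ, Finset.mul_sum,
      Finset.mul_sum, ← Finset.sum_sub_distrib]
    refine Finset.sum_congr rfl fun μ _ => ?_
    unfold ExpKernelCalculus.hess
    ring
  -- localisation of `divV`
  have hD : BiLoc (divV V y) P P _ δ := biLoc_finset_sum Finset.univ fun μ hμ => biLoc_sub (hV₁ μ hμ) (hV₂ μ hμ)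
  have hAD := biLoc_comp_decays hA hD (show 0 ≤ δ / 2 by linarith) (show δ / 2 < δ by linarith)
  have hAX := biLoc_comp_decays hA hXy (show 0 ≤ δ / 2 by linarith) (show δ / 2 < δ by linarith)
  have hAV' := biLoc_comp_decays hA hV' (show 0 ≤ δ / 2 by linarith) (show δ / 2 < δ by linarith)
  have hXV' := biLoc_comp_biLoc hXy hV' hδ
  have hV'X := biLoc_comp_biLoc hV' hXy hδ
  have hV'2 : BiLoc (V ν y') Q Q Cv (δ / 2) := fun x z a b => (hV' x z a b).trans (by
    have hc : 0 ≤ Cv := hV'.nonneg a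
    refine mul_le_mul_of_nonneg_left (Real.exp_le_exp.mpr ?_) hc
    nlinarith [l1_nonneg (x - Q), l1_nonneg (z - Q), hδ.le])
  have hXy2 : BiLoc (X y) P P Cx (δ / 2) := fun x z a b => (hXy x z a b).trans (by
    have hc : 0 ≤ Cx := hXy.nonneg a
    refine mul_le_mul_of_nonneg_left (Real.exp_le_exp.mpr ?_) hc
    nlinarith [l1_nonneg (x - P), l1_nonneg (z - P), hδ.le])
  have hA2 : Decays A C (δ / 2) := fun x z a b => (hA x z a b).trans (by
    have hc : 0 ≤ C := hA.nonneg a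
    refine mul_le_mul_of_nonneg_left (Real.exp_le_exp.mpr ?_) hc
    nlinarith [l1_nonneg (x - z), hδ.le])
  -- step 2: the bubble term `tr((A∘divV)∘(A∘V′)) = tr(((A∘divV)∘A)∘V′) = tr((A∘X)∘V′) − tr(X∘(A∘V′))`
  have e2 : bubble A (divV V y) (V ν y') = tr (comp (comp A (X y)) (V ν y')) - tr (comp (X y) (comp A (V ν y'))) := by
    unfold ExpKernelCalculus.bubble
    rw [comp_assoc_bdb hAD hA2 hV'2 hδ2, hW1 y]
    rw [comp_sub_left (slices_biLoc_bdd hAX (bdd_of_biLoc hV' hδ.le) hδ2) ?_]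
    · rw [← comp_assoc_bdb hXy2 hA2 hV'2 hδ2]
      exact tr_sub (summable_trTerm (biLoc_comp_biLoc hAX hV'2 hδ2) hδ2)
        (summable_trTerm (biLoc_comp_biLoc hXy2 hAV' hδ2) hδ2)
    · -- slices of `(X ∘ A) ∘ V′`: rewrite `X ∘ A ∘ V′`-wise is not available termwise; bound `X ∘ A` instead
      intro x z a b
      have hXA : Bdd (comp (X y) A) ((Fintype.card F : ℝ) * (Cx * C) * Zl D δ) := by
        intro u v c e
        have hc : 0 ≤ Cx := hXy.nonneg c
        have hC : 0 ≤ C := hA.nonneg c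
        show |∑' t, ∑ f, X y u t c f * A t v f e| ≤ _
        have hs := summable_exp_shift' hδ P
        have hmaj := hs.mul_left ((Fintype.card F : ℝ) * (Cx * C))
        have hb := tsum_of_norm_bounded hmaj.hasSum (fun t => by
          rw [Real.norm_eq_abs]
          calc |∑ f, X y u t c f * A t v f e| ≤ ∑ f, |X y u t c f * A t v f e| := Finset.abs_sum_le_sum_abs _ _
            _ ≤ ∑ _f : F, Cx * C * Real.exp (-δ * l1 (t - P)) := Finset.sum_le_sum fun f _ => by
                rw [abs_mul]
                have h1 : |X y u t c f| ≤ Cx * Real.exp (-δ * l1 (t - P)) := by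
                  refine (hXy u t c f).trans (mul_le_mul_of_nonneg_left (Real.exp_le_exp.mpr ?_) hc)
                  nlinarith [l1_nonneg (u - P), hδ.le]
                have h2 : |A t v f e| ≤ C := hAb t v f e
                calc |X y u t c f| * |A t v f e| ≤ (Cx * Real.exp (-δ * l1 (t - P))) * C :=
                      mul_le_mul h1 h2 (abs_nonneg _) (by positivity)
                  _ = Cx * C * Real.exp (-δ * l1 (t - P)) := by ring
            _ = (Fintype.card F : ℝ) * (Cx * C) * Real.exp (-δ * l1 (t - P)) := by
                rw [Finset.sum_const, Finset.card_univ, nsmul_eq_mul]; ring)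
        rw [Real.norm_eq_abs] at hb
        refine hb.trans (le_of_eq ?_)
        rw [tsum_mul_left, tsum_exp_shift']
      exact slices_bdd_biLoc hXA hV' hδ x z a b
  -- step 3: the tadpole term `tr(A∘(X∘V′ − V′∘X)) = tr((A∘X)∘V′) − tr(X∘(A∘V′))`
  have e3 : tadpole A (divW W y ν y') = tr (comp (comp A (X y)) (V ν y')) - tr (comp (X y) (comp A (V ν y'))) := by
    unfold ExpKernelCalculus.tadpole
    rw [hW2 y ν y', comp_sub_right (slices_bdd_biLoc hAb hXV' hδ) (slices_bdd_biLoc hAb hV'X hδ)]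
    rw [tr_sub (summable_trTerm (biLoc_comp_decays hA hXV' (show 0 ≤ δ / 2 by linarith) (show δ / 2 < δ by linarith)) hδ2)
      (summable_trTerm (biLoc_comp_decays hA hV'X (show 0 ≤ δ / 2 by linarith) (show δ / 2 < δ by linarith)) hδ2)]
    rw [comp_assoc_dbb hA hXy hV' hδ, comp_assoc_dbb hA hV' hXy hδ, tr_comp_comm_bb hAV' hXy2 hδ2]
  rw [e1, e2, e3]
  ring

/-- **THE DIFFERENCE-VARIABLE FORM**: under block-translation covariance the Ward identity of `ward_hess` is the FORWARD first-index
divergence law of the kernel `hessKer`: `Σ_μ (hessKer μ ν (z + e_μ) − hessKer μ ν z) = 0` — i.e. the printed (5.9)/(5.15)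
predicate `PolarizationSign.WardTransversal` of the FLIPPED kernel `z ↦ hessKer μ ν (−z)` (`hessKer`'s variable is second-minus-first;
cf. `OneStepKernelFamily.wardTransversal_flipK_iff`). [folklore] (Locator of the printed law, orientation only:
[cite: Balaban1987RG1, (5.9), (5.15) p.293].) -/
theorem wardTransversal_flip_hessKer {A : ExpKernelCalculus.MKer D F} {V : Fin D → (Fin D → ℤ) → ExpKernelCalculus.MKer D F}
    {W : Fin D → (Fin D → ℤ) → Fin D → (Fin D → ℤ) → ExpKernelCalculus.MKer D F} {C Cv Cw Cx δ : ℝ} {N : ℕ}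
    (X : (Fin D → ℤ) → ExpKernelCalculus.MKer D F)
    (hA : Decays A C δ) (hV : VertexFamily V N Cv δ) (hW : VertexFamily₂ W N Cw δ)
    (hX : ∀ y, BiLoc (X y) ((N : ℤ) • y) ((N : ℤ) • y) Cx δ) (hδ : 0 < δ) (hcov : BlockCovariant A V W N)
    (hW1 : ∀ y, comp (comp A (divV V y)) A = comp A (X y) - comp (X y) A)
    (hW2 : ∀ y ν y', divW W y ν y' = comp (X y) (V ν y') - comp (V ν y') (X y)) :
    WardTransversal (fun μ ν z => hessKer A V W μ ν (-z)) := by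
  intro ν z
  have h := ward_hess X hA hV hW hX hδ hW1 hW2 0 ν (-z)
  have e : ∀ μ : Fin D, hess A V W μ (0 - unitVec μ) ν (-z) - hess A V W μ 0 ν (-z)
      = hessKer A V W μ ν (-(z - unitVec μ)) - hessKer A V W μ ν (-z) := by
    intro μ
    rw [hess_eq_hessKer hcov, hess_eq_hessKer hcov]
    congr 2 <;> abel
  simpa only [e] using h

end

end Literature.MathematicalPhysics.QuantumFieldTheory.Balaban1983to89.Beta.KernelWard
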